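import Mathlib
import Summits.Ventures.DiscreteObjects.Mahler.SmythIsolationCaseA

/-!
# Smyth's theorem, isolation of `θ₀` — the case `ℓ < 2k` with the book's exact constant
(venture `DiscreteObjects`, target L)

Cell `pub-namedobj`, seat `pub-namedobj-mahler` (gen 9). Framing: lottery ticket; floor = certified
bounds/negative ranges.

`SmythIsolationCaseA` records the case `ℓ < 2k` of [McKee–Smyth, *Around the Unit Circle*, §12.2.2] with
the decimal conclusion `c ≤ 0.7548`.  Here we keep the exact form (12.13): the Parseval family forces
`40c⁴ - 93c² + 40 ≥ 0`, whence (as `c² < (93+√2249)/80`, the larger root) `c² ≤ (93-√2249)/80`, i.e.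
`M(P)² = c⁻² ≥ (93+√2249)/80` and `M(P) ≥ √((93+√2249)/80) = 1.32487…`, the constant printed in Thm 12.1.

* `smyth_caseA_arith_quartic` — the endgame with conclusion `0 ≤ 40c⁴ - 93c² + 40`;
* `smyth_quartic_root_bound` — `40u² - 93u + 40 ≥ 0`, `0 ≤ u ≤ 0.62` ⟹ `(93+√2249)/80 ≤ u⁻¹`;
* `SmythData.caseA_exact`, `smyth_analytic_caseA_exact` — `√((93+√2249)/80) ≤ c⁻¹` in the case `ℓ < 2k`;
* `sqrt_smyth_gap_const_bounds` — `1.3248 < √((93+√2249)/80) < 1.325`.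
-/

namespace Summit.Ventures.DiscreteObjects.Mahler

open Polynomial

/-- **§12.2.2 endgame, quartic form (12.13).**  Under the hypotheses of `smyth_caseA_arith`:
`40c⁴ - 93c² + 40 ≥ 0`. -/
theorem smyth_caseA_arith_quartic {c x : ℝ} (hc : 3 / 4 ≤ c) (hc2 : c / 2 ≤ 1 - c ^ 2) (hx : |x| ≤ 1 - c ^ 2)
    (h : ∀ β γ : ℝ, 5 * c ^ 2 / 4 + (x + γ * c) ^ 2 + (c / 2 + x / 2 - γ * c / 2 + β * c) ^ 2 ≤
      2 + γ ^ 2 + β ^ 2) : 0 ≤ 40 * c ^ 4 - 93 * c ^ 2 + 40 := by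
  have hc78 : c ≤ 781 / 1000 := by nlinarith
  have h1c : 0 < 1 - c ^ 2 := by nlinarith
  obtain ⟨hxlo, hxhi⟩ := abs_le.mp hx
  set D2 : ℝ := 4 * c ^ 4 - 9 * c ^ 2 + 4 with hD2def
  set B : ℝ := 2 * c * (x * (3 - 4 * c ^ 2) - c) with hBdef
  set C0 : ℝ := 4 * (1 - c ^ 2) * (5 * c ^ 2 / 4 - 2) + 4 * (1 - c ^ 2) * x ^ 2 + (c + x) ^ 2 with hC0def
  have hD2nn : 0 ≤ D2 := by
    have e : D2 = (2 * c ^ 2 + c - 2) * (2 * c ^ 2 - c - 2) := by rw [hD2def]; ring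
    rw [e]
    apply mul_nonneg_of_nonpos_of_nonpos <;> nlinarith
  have hquad : ∀ γ : ℝ, (-D2) * γ ^ 2 + B * γ + C0 ≤ 0 := by
    intro γ
    set K : ℝ := (c + x - γ * c) / 2 with hK
    have hh := h (K * c / (1 - c ^ 2)) γ
    have iden : 4 * (1 - c ^ 2) * (5 * c ^ 2 / 4 + (x + γ * c) ^ 2 +
        (c / 2 + x / 2 - γ * c / 2 + K * c / (1 - c ^ 2) * c) ^ 2 - (2 + γ ^ 2 + (K * c / (1 - c ^ 2)) ^ 2))
        = (-D2) * γ ^ 2 + B * γ + C0 := by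
      rw [hD2def, hBdef, hC0def, hK]
      field_simp
      ring
    have : 4 * (1 - c ^ 2) * (5 * c ^ 2 / 4 + (x + γ * c) ^ 2 +
        (c / 2 + x / 2 - γ * c / 2 + K * c / (1 - c ^ 2) * c) ^ 2 - (2 + γ ^ 2 + (K * c / (1 - c ^ 2)) ^ 2))
        ≤ 0 := by
      apply mul_nonpos_of_nonneg_of_nonpos (by linarith) (by linarith)
    linarith
  obtain ⟨hdisc, hdeg⟩ := quad_forall_nonpos (by linarith) hquad
  have hΦ : B ^ 2 + 4 * D2 * C0 ≤ 0 := by linarith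
  by_cases hD : D2 = 0
  · -- degenerate case: `B = 0`, i.e. `x (3 - 4c²) = c`, impossible for `|x| ≤ 1 - c²`
    exfalso
    have hB : B = 0 := hdeg (by linarith)
    have hcx : x * (3 - 4 * c ^ 2) = c := by
      have : 2 * c * (x * (3 - 4 * c ^ 2) - c) = 0 := by rw [hBdef] at hB; exact hB
      have hc0 : (2 * c) ≠ 0 := by linarith
      have := (mul_eq_zero.mp this).resolve_left hc0
      linarith
    nlinarith
  · have hDpos : 0 < D2 := lt_of_le_of_ne hD2nn (Ne.symm hD)
    have hα : 0 < 16 * (1 - c ^ 2) * (5 - 8 * c ^ 2) := by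
      have : 0 < 5 - 8 * c ^ 2 := by nlinarith
      positivity
    have iden2 : 4 * (16 * (1 - c ^ 2) * (5 - 8 * c ^ 2)) * (B ^ 2 + 4 * D2 * C0) =
        (2 * (16 * (1 - c ^ 2) * (5 - 8 * c ^ 2)) * x + (64 * c ^ 5 - 96 * c ^ 3 + 32 * c)) ^ 2 -
          256 * (40 * c ^ 4 - 93 * c ^ 2 + 40) * D2 * (1 - c ^ 2) ^ 2 := by
      rw [hBdef, hC0def, hD2def]; ring
    have h1 : 4 * (16 * (1 - c ^ 2) * (5 - 8 * c ^ 2)) * (B ^ 2 + 4 * D2 * C0) ≤ 0 :=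
      mul_nonpos_of_nonneg_of_nonpos (by positivity) hΦ
    have h4 : 0 < 256 * D2 * (1 - c ^ 2) ^ 2 := by positivity
    by_contra hneg
    push Not at hneg
    have : 256 * (40 * c ^ 4 - 93 * c ^ 2 + 40) * D2 * (1 - c ^ 2) ^ 2 < 0 := by
      have : 256 * (40 * c ^ 4 - 93 * c ^ 2 + 40) * D2 * (1 - c ^ 2) ^ 2 =
          (40 * c ^ 4 - 93 * c ^ 2 + 40) * (256 * D2 * (1 - c ^ 2) ^ 2) := by ring
      rw [this]; exact mul_neg_of_neg_of_pos hneg h4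
    nlinarith [sq_nonneg (2 * (16 * (1 - c ^ 2) * (5 - 8 * c ^ 2)) * x + (64 * c ^ 5 - 96 * c ^ 3 + 32 * c))]

/-- The root bound: `40u² - 93u + 40 ≥ 0` with `0 < u ≤ 0.62` forces `u ≤ (93-√2249)/80`, i.e.
`(93+√2249)/80 ≤ u⁻¹` (the two roots `(93∓√2249)/80` have product `1`). -/
theorem smyth_quartic_root_bound {u : ℝ} (hu0 : 0 < u) (hu1 : u ≤ 62 / 100)
    (h : 0 ≤ 40 * u ^ 2 - 93 * u + 40) : (93 + Real.sqrt 2249) / 80 ≤ u⁻¹ := by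
  set s := Real.sqrt 2249 with hs
  have hs2 : s ^ 2 = 2249 := Real.sq_sqrt (by norm_num)
  have hs0 : 0 ≤ s := Real.sqrt_nonneg _
  have hslo : 47 < s := by nlinarith
  have hshi : s < 48 := by nlinarith
  -- `40u² - 93u + 40 = 40 (u - u₋)(u - u₊)`, `u₋ u₊ = 1`
  have hfac : 40 * u ^ 2 - 93 * u + 40 = 40 * (u - (93 - s) / 80) * (u - (93 + s) / 80) := by
    nlinarith [hs2]
  have hlt : u - (93 + s) / 80 < 0 := by linarith
  have hule : u ≤ (93 - s) / 80 := by
    by_contra hgt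
    push Not at hgt
    have : 40 * (u - (93 - s) / 80) * (u - (93 + s) / 80) < 0 :=
      mul_neg_of_pos_of_neg (by linarith) hlt
    linarith
  -- `u⁻¹ ≥ 80/(93 - s) = (93 + s)/80`
  rw [le_inv_comm₀ (by positivity) hu0]
  have hprod : (93 - s) / 80 * ((93 + s) / 80) = 1 := by nlinarith [hs2]
  calc ((93 + s) / 80)⁻¹ = (93 - s) / 80 := (eq_inv_of_mul_eq_one_left hprod).symm
    _ ≥ u := hule

/-- Numerical enclosure of the book's constant: `1.3248 < √((93+√2249)/80) < 1.325`. -/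
theorem sqrt_smyth_gap_const_bounds :
    (13248 : ℝ) / 10000 < Real.sqrt ((93 + Real.sqrt 2249) / 80) ∧
      Real.sqrt ((93 + Real.sqrt 2249) / 80) < 1325 / 1000 := by
  set s := Real.sqrt 2249 with hs
  have hs2 : s ^ 2 = 2249 := Real.sq_sqrt (by norm_num)
  have hs0 : 0 ≤ s := Real.sqrt_nonneg _
  have hslo : 4742 / 100 < s := by nlinarith
  have hshi : s < 4743 / 100 := by nlinarith
  constructor
  · rw [show (13248 : ℝ) / 10000 = Real.sqrt ((13248 / 10000) ^ 2) by rw [Real.sqrt_sq (by norm_num)]]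
    apply Real.sqrt_lt_sqrt (by positivity)
    nlinarith
  · rw [show (1325 : ℝ) / 1000 = Real.sqrt ((1325 / 1000) ^ 2) by rw [Real.sqrt_sq (by norm_num)]]
    apply Real.sqrt_lt_sqrt (by positivity)
    nlinarith

namespace SmythData

variable {f g : ℂ → ℂ} {c : ℝ}

/-- **Case `ℓ < 2k` with `a = +1`, exact form:** `√((93+√2249)/80) ≤ c⁻¹`. -/
theorem caseA_exact (D : SmythData f g c) {k ℓ : ℕ} (hkl : k < ℓ) (hl : ℓ < 2 * k) {b : ℤ}
    (hb : b = 1 ∨ b = -1) (hc : 3 / 4 ≤ c) (hc2 : c / 2 ≤ 1 - c ^ 2)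
    (hy : (jetCoeff f (ℓ - k)).re = (jetCoeff g (ℓ - k)).re)
    (hw : (jetCoeff f (2 * k - ℓ)).re = (jetCoeff g (2 * k - ℓ)).re)
    (hrelk : (jetCoeff f k).re = (jetCoeff g k).re + c)
    (hrell : (jetCoeff f ℓ).re = (jetCoeff g ℓ).re + (jetCoeff g (ℓ - k)).re + b * c) :
    Real.sqrt ((93 + Real.sqrt 2249) / 80) ≤ c⁻¹ := by
  have hPf := D.parsevalA_f hkl hl
  have hPg := D.parsevalA_g hkl hl
  have hyb : |(jetCoeff f (ℓ - k)).re| ≤ 1 - c ^ 2 := D.abs_re_le (n := ℓ - k) (by omega)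
  set y := (jetCoeff f (ℓ - k)).re with hy'
  set w := (jetCoeff f (2 * k - ℓ)).re with hw'
  set Fk := (jetCoeff f k).re with hFk
  set Fl := (jetCoeff f ℓ).re with hFl
  set Gk := (jetCoeff g k).re with hGk
  set Gl := (jetCoeff g ℓ).re with hGl
  rw [← hy] at hPg hrell
  rw [← hw] at hPg
  have hcomb : ∀ β γ : ℝ, 5 * c ^ 2 / 4 + (y + γ * c) ^ 2 +
      (b * c / 2 - y / 2 + γ * c / 2 + β * c) ^ 2 ≤ 2 + γ ^ 2 + β ^ 2 := by
    intro β γ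
    have h1 := hPf β γ
    have h2 := hPg β γ
    rw [hrelk, hrell] at h1
    nlinarith [h1, h2, sq_nonneg ((Gk + c + γ * w - c) + (Gk + γ * w + c)),
      sq_nonneg ((Gl + y + b * c + γ * (Gk + c) - y + β * c) + (Gl + γ * Gk + y - β * c))]
  have hquart : 0 ≤ 40 * c ^ 4 - 93 * c ^ 2 + 40 := by
    rcases hb with hb1 | hb1
    · subst hb1
      refine smyth_caseA_arith_quartic hc hc2 (x := -y) (by rw [abs_neg]; exact hyb) (fun β' γ' => ?_)
      have := hcomb β' (-γ')
      push_cast at this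
      nlinarith [this]
    · subst hb1
      refine smyth_caseA_arith_quartic hc hc2 (x := y) hyb (fun β' γ' => ?_)
      have := hcomb (-β') γ'
      push_cast at this
      nlinarith [this]
  have hc78 : c ≤ 781 / 1000 := by nlinarith
  have hu := smyth_quartic_root_bound (u := c ^ 2) (by positivity) (by nlinarith)
    (by nlinarith [hquart])
  rw [← inv_pow] at hu
  have h1 := Real.sqrt_le_sqrt hu
  rwa [Real.sqrt_sq (inv_nonneg.mpr D.cpos.le)] at h1

end SmythData

/-- **Smyth's inequality, case `ℓ < 2k`, exact form (12.13).**  A Smyth pair with the nonreciprocity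
relations `fₙ = gₙ + a g_{n-k} [k ≤ n] + b c [n = ℓ]` for `n ≤ ℓ` (`1 ≤ k < ℓ < 2k`, integers
`a, b ≠ 0`) has `c⁻¹ ≥ √((93+√2249)/80) = 1.32487…`, the constant of [McKee–Smyth, Thm 12.1]. -/
theorem smyth_analytic_caseA_exact {f g : ℂ → ℂ} {c : ℝ} (D : SmythData f g c) {k ℓ : ℕ} (hk : 1 ≤ k)
    (hkl : k < ℓ) (hl2 : ℓ < 2 * k) {a b : ℤ} (ha : a ≠ 0) (hb : b ≠ 0)
    (hrel : ∀ n, n ≤ ℓ → (jetCoeff f n).re = (jetCoeff g n).re +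
      (if k ≤ n then (a : ℝ) * (jetCoeff g (n - k)).re else 0) + (if n = ℓ then (b : ℝ) * c else 0)) :
    Real.sqrt ((93 + Real.sqrt 2249) / 80) ≤ c⁻¹ := by
  by_cases hc : c < 3 / 4
  · -- `c⁻¹ > 4/3 > 1.325`
    have h43 : (4 : ℝ) / 3 < c⁻¹ := by
      rw [lt_inv_comm₀ (by norm_num) D.cpos]; norm_num; exact hc
    linarith [sqrt_smyth_gap_const_bounds.2]
  push Not at hc
  have hrelk : (jetCoeff f k).re = (jetCoeff g k).re + a * c := by
    have h := hrel k hkl.le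
    rw [if_pos le_rfl, if_neg (by omega), Nat.sub_self, D.symm.re_f0] at h
    linarith
  obtain ⟨ha1, _, hc2⟩ := smyth_orderK hc (D.abs_re_le hk) (D.symm.abs_re_le hk) ha hrelk
  have hrell : (jetCoeff f ℓ).re = (jetCoeff g ℓ).re + a * (jetCoeff g (ℓ - k)).re + b * c := by
    have h := hrel ℓ le_rfl
    rw [if_pos hkl.le, if_pos rfl] at h
    exact h
  have hb1 : b = 1 ∨ b = -1 :=
    smyth_b_bound hc ha1 (D.abs_re_le (n := ℓ) (by omega)) (D.symm.abs_re_le (n := ℓ) (by omega))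
      (D.symm.abs_re_le (n := ℓ - k) (by omega)) hb hrell
  have hy : (jetCoeff f (ℓ - k)).re = (jetCoeff g (ℓ - k)).re := by
    have h := hrel (ℓ - k) (by omega)
    rw [if_neg (by omega), if_neg (by omega)] at h
    linarith
  have hw : (jetCoeff f (2 * k - ℓ)).re = (jetCoeff g (2 * k - ℓ)).re := by
    have h := hrel (2 * k - ℓ) (by omega)
    rw [if_neg (by omega), if_neg (by omega)] at h
    linarith
  rcases ha1 with h1 | h1
  · subst h1
    push_cast at hrelk hrell
    exact D.caseA_exact hkl hl2 hb1 hc hc2 hy hw (by linarith) (by linarith)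
  · subst h1
    push_cast at hrelk hrell
    have hb1' : (-b) = 1 ∨ (-b) = -1 := by omega
    refine D.symm.caseA_exact hkl hl2 hb1' hc hc2 hy.symm hw.symm (by linarith) ?_
    push_cast
    linarith

end Summit.Ventures.DiscreteObjects.Mahler
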